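import Summits.BirchSwinnertonDyer.BirchSwinnertonDyer.Theses.GenusKolyvaginAtTwo
import Summits.BirchSwinnertonDyer.BirchSwinnertonDyer.Theorems.GenusKolyvaginAtTwoMinimalTwinBSDTwoSwappedPairFrame
import HarnessLib

/-!
# Route `GenusKolyvaginAtTwo`, crux U₂ `MinimalTwinBSDTwo` (stmt-BirchSwinnertonDyer-22985): U₂ IS A PURE L-VALUE STATEMENT —
# on its habitat (`r_an = 1`, `#Sel₂ = 2`) the `2`-primary part of `Ш(W/ℚ)` VANISHES (mod GZK), so `BSD₂(W)` ⟺ «`#Ш_an(W)` is a `2`-adic unit»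

Seat `bsd-line-gk2-p3` g28 (PROVER seat 3/3, cell `bsd-f1-sign2`), `--supports stmt-BirchSwinnertonDyer-22985` (helper; closes nothing).
THEOREMS ONLY (no definition, no named fact, no `sorry`); standard axioms.  **BSD is NOT proved by this file; U₂ is NOT proved; no item is
closed.**  §1–§2 are UNCONDITIONAL; §3 is CONDITIONAL (D-0014) on the STATEMENT-ONLY print fact Gross–Zagier–Kolyvagin
(`rank_eq_analyticRank_of_analyticRank_le_one`, item 19921; binder `hGZK`), used only to turn `r_an(W) = 1` into `rank W(ℚ) ≥ 1`.

THE POINT (planner currency).  `BSDp W 2` := `rank = r_an ∧ Ш(W)[2^∞] finite ∧ #Ш_an(W) ∈ ℚ with ord₂ #Ш_an(W) = ord₂ #Ш(W)[2^∞]`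
(`Literature…bsdp_iff`, Miller Def. 1.1).  On U₂'s habitat `#Sel₂(W) = 2` with `rank W(ℚ) ≥ 1` forces `rank = 1`, `W(ℚ)[2] = 0` and
`Ш(W/ℚ)[2^∞] = 0` (gk2-p2 g23's `TwinSwap.rank_eq_one_and_sha_primary_eq_zero_of_natCard_selmerGroup_eq_two`: `2 = #Sel₂ = 2^{rank}·#W(ℚ)[2]·#Ш[2]`).
Hence (§2) `BSD₂(W) ⟺ ∃ q ∈ ℚ, #Ш_an(W) = q ∧ ord₂ q = 0`, and (§3) **U₂ ⟺ «for every non-CM globally minimal `W` with `r_an = 1` and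
`#Sel₂ = 2`, `#Ш_an(W) = L′(E,1)/(Ω_E R_E C(E)) · #E(ℚ)_tors²` is a rational `2`-ADIC UNIT»** — no `Ш`-term is involved at all; with `#E(ℚ)_tors`
odd this reads `ord₂ (L′(E,1)/(Ω_E R_E)) = ord₂ C(E)`, i.e. `= 0` on the cell `hTw0`, `= 1` on `hTw1`, `= 2` on `hTw2` (this seat's ledger
`…RouteLedgerLine25*`).  The same pointwise equivalence (§2) applies verbatim on every sliced cell (`hTw0ˢ`, `hTw1ˢ`, …).

* §1 `finite_and_natCard_primaryComponent_sha_two_eq_one_of_natCard_selmerGroup_eq_two` — `#Sel₂(W) = 2`, `rank ≥ 1` ⟹ `Ш(W)[2^∞]` finite of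
  order `1` (UNCONDITIONAL).
* §2 `bsdp_two_iff_padicValRat_shaAn_eq_zero` — for `r_an(W) = 1`, `rank ≥ 1`, `#Sel₂(W) = 2`: `BSDp W 2 ⟺ ∃ q, shaAn W = q ∧ padicValRat 2 q = 0`
  (UNCONDITIONAL); `…_of_facts`: the same from `r_an = 1`, `#Sel₂ = 2` and `hGZK`.
* §3 `minimalTwinBSDTwo_iff_shaAn_two_adic_unit_of_facts` — `MinimalTwinBSDTwo ⟺ (∀ W …, ¬CM → r_an = 1 → #Sel₂ = 2 → ∃ q, shaAn W = q ∧
  padicValRat 2 q = 0)` (mod `hGZK`).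

References: [Miller2011LMS] Def. 1.1; [GrossZagier1986] I.(6.3), V.(2.2); [Kolyvagin1989Izv] Thm. A; [SilvermanAEC2009] X.4.2.
-/

set_option autoImplicit false
set_option linter.dupNamespace false -- `Summit.<P>.<Sub>` repeats `BirchSwinnertonDyer` (D-0017)

noncomputable section

open scoped Classical

open WeierstrassCurve NumberField Literature.NumberTheory.EllipticCurves
  Summit.BirchSwinnertonDyer.BirchSwinnertonDyer.Theses.GenusKolyvaginAtTwo
  Summit.BirchSwinnertonDyer.BirchSwinnertonDyer.Theorems.GenusExact.TwinSwap

namespace Summit.BirchSwinnertonDyer.BirchSwinnertonDyer.Theorems.GenusExact.TwinSwap.ShaAnUnit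

/-! ## §1 `Ш(W/ℚ)[2^∞] = 0` on U₂'s habitat -/

/-- **`#Sel₂(W) = 2` and `rank W(ℚ) ≥ 1` ⟹ `Ш(W/ℚ)[2^∞]` is finite of order `1`** (UNCONDITIONAL): the `2`-primary component is `⊥` by
g23's `rank_eq_one_and_sha_primary_eq_zero_of_natCard_selmerGroup_eq_two`.  [cite: SilvermanAEC2009, X.4.2] [cite: Miller2011LMS, Def. 1.1] -/
theorem finite_and_natCard_primaryComponent_sha_two_eq_one_of_natCard_selmerGroup_eq_two
    (W : WeierstrassCurve ℚ) [W.IsElliptic] (hSel : Nat.card (W.selmerGroup 2) = 2) (hrk : 1 ≤ W.mordellWeilRank) :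
    Finite (AddCommGroup.primaryComponent (↥W.sha) 2) ∧ Nat.card (AddCommGroup.primaryComponent (↥W.sha) 2) = 1 := by
  haveI : Fact (Nat.Prime 2) := ⟨Nat.prime_two⟩
  obtain ⟨-, -, hsha⟩ := rank_eq_one_and_sha_primary_eq_zero_of_natCard_selmerGroup_eq_two W hSel hrk
  have hbot : AddCommGroup.primaryComponent (↥W.sha) 2 = ⊥ := (AddSubgroup.eq_bot_iff_forall _).mpr hsha
  rw [hbot]
  exact ⟨inferInstance, AddSubgroup.card_bot⟩

/-! ## §2 `BSD₂(W)` ⟺ «`#Ш_an(W)` is a rational `2`-adic unit» -/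

/-- **`BSD₂(W) ⟺ ∃ q ∈ ℚ, #Ш_an(W) = q ∧ ord₂ q = 0`** for `W` with `r_an(W) = 1`, `rank W(ℚ) ≥ 1`, `#Sel₂(W) = 2` (UNCONDITIONAL: by §1 the
`Ш`-side of Miller's `BSDp W 2` is `ord₂ 1 = 0`, and `rank = 1 = r_an`).  [cite: Miller2011LMS, Def. 1.1] [cite: SilvermanAEC2009, X.4.2] -/
theorem bsdp_two_iff_padicValRat_shaAn_eq_zero (W : WeierstrassCurve ℚ) [W.IsElliptic] (hr : W.analyticRank = 1)
    (hrk : 1 ≤ W.mordellWeilRank) (hSel : Nat.card (W.selmerGroup 2) = 2) :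
    BSDp W 2 ↔ ∃ q : ℚ, shaAn W = (q : ℂ) ∧ padicValRat 2 q = 0 := by
  obtain ⟨hfin, hcard⟩ := finite_and_natCard_primaryComponent_sha_two_eq_one_of_natCard_selmerGroup_eq_two W hSel hrk
  obtain ⟨hrk1, -, -⟩ := rank_eq_one_and_sha_primary_eq_zero_of_natCard_selmerGroup_eq_two W hSel hrk
  rw [bsdp_iff]
  constructor
  · rintro ⟨-, -, q, hq, hv⟩
    refine ⟨q, hq, ?_⟩
    rw [hv, hcard]
    simp
  · rintro ⟨q, hq, hv⟩
    refine ⟨by rw [hrk1, hr], hfin, q, hq, ?_⟩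
    rw [hv, hcard]
    simp

/-- **The same from the print fact GZK** (`rank_eq_analyticRank_of_analyticRank_le_one`: `r_an ≤ 1 ⟹ rank = r_an`): for `W` with `r_an(W) = 1`
and `#Sel₂(W) = 2`, `BSD₂(W) ⟺ ∃ q ∈ ℚ, #Ш_an(W) = q ∧ ord₂ q = 0`.  CONDITIONAL on `hGZK` only.  [cite: Miller2011LMS, Def. 1.1]
[cite: Kolyvagin1989Izv, Thm. A] -/
theorem bsdp_two_iff_padicValRat_shaAn_eq_zero_of_facts (hGZK : rank_eq_analyticRank_of_analyticRank_le_one)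
    (W : WeierstrassCurve ℚ) [W.IsElliptic] (hr : W.analyticRank = 1) (hSel : Nat.card (W.selmerGroup 2) = 2) :
    BSDp W 2 ↔ ∃ q : ℚ, shaAn W = (q : ℂ) ∧ padicValRat 2 q = 0 := by
  have hrk : 1 ≤ W.mordellWeilRank := by
    have h := (hGZK W (le_of_eq hr)).1
    omega
  exact bsdp_two_iff_padicValRat_shaAn_eq_zero W hr hrk hSel

/-! ## §3 U₂ `MinimalTwinBSDTwo` ⟺ «`#Ш_an` is a `2`-adic unit on the habitat» -/

/-- **U₂ IS A PURE L-VALUE STATEMENT (mod GZK).**  `MinimalTwinBSDTwo` (stmt-22985, verbatim the route decl) is EQUIVALENT to: for every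
non-CM globally minimal `W/ℚ` with `r_an(W) = 1` and `#Sel₂(W) = 2`, `#Ш_an(W)` (`= L′(E,1)/(Ω_E R_E C(E)) · #E(ℚ)_tors²`) is a rational number
of `2`-adic valuation `0`.  No `Ш`-term: `Ш(W/ℚ)[2^∞] = 0` automatically (§1).  CONDITIONAL on `hGZK` only; proves nothing about BSD by itself;
closes no item.  [cite: Miller2011LMS, Def. 1.1] [cite: GrossZagier1986, V.(2.2)] [cite: Kolyvagin1989Izv, Thm. A] -/
theorem minimalTwinBSDTwo_iff_shaAn_two_adic_unit_of_facts (hGZK : rank_eq_analyticRank_of_analyticRank_le_one) :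
    MinimalTwinBSDTwo ↔
      ∀ (W : WeierstrassCurve ℚ) [W.IsElliptic] [W.IsGloballyMinimal], ¬ W.HasCM → W.analyticRank = 1 →
        Nat.card (W.selmerGroup 2) = 2 → ∃ q : ℚ, shaAn W = (q : ℂ) ∧ padicValRat 2 q = 0 := by
  constructor
  · intro hTw W _ _ hcm hr hSel
    exact (bsdp_two_iff_padicValRat_shaAn_eq_zero_of_facts hGZK W hr hSel).mp (hTw W hcm hr hSel)
  · intro h W _ _ hcm hr hSel
    exact (bsdp_two_iff_padicValRat_shaAn_eq_zero_of_facts hGZK W hr hSel).mpr (h W hcm hr hSel)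

end Summit.BirchSwinnertonDyer.BirchSwinnertonDyer.Theorems.GenusExact.TwinSwap.ShaAnUnit

end
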